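import Summits.QuantumFields.YangMills.Theorems.VirialFluxGapAnchoredProfileBaseMotion
import HarnessLib

/-!
# Route `VirialFluxGap` (YangMills): quaternion-valued curve calculus for the explicit central field — components, conjugation, the lift along a curve, and
# the derivative of the anchored entry `Im_b(conj(lift σ z(s))·q(s))` (brick (1c) of the central chart of ⟨stmt-QuantumFields-24141⟩; free-hands helper)

Width seat `ym-line-sfw-p2-w3` g59 (cell ym-idea-1, free hands), `--supports stmt-QuantumFields-24141`.

The divergence of the explicit central field `X_c = X_z + U` (LEAD ruling (A), 2026-08-31; defs ⧗`VirialFluxGapCentralFieldDefs`) is computed slot by slot along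
the own frame curves of each variable: the entry of the field at a wrap-block variable is `Im_b(conj(liftQuat σ z(s))·q(s)) + ½σ z_b(s)` where, along the curve in the
unit direction `u_a`, the variable's quaternion moves with `q̇ = q·u_a` and the block average with `ż = N⁻¹·Im(q·u_a)`.  This file supplies the `ℍ`-valued one-variable
calculus for that computation, abstract in the curves (the lattice instantiation is the next brick):

* §1 components: `exists_quatComponent_clm` (`re, imI, imJ, imK` as continuous linear functionals), `hasDerivAt_quatComponents`, `quat_eq_smul_zUnit_sum`,
  `hasDerivAt_quat_of_components`, `smul_zUnit_sum_components`;
* §2 ★ `hasDerivAt_quat_star` (`d/ds conj(f) = conj(ḟ)`, via components — no `StarModule` instance needed), ★ `hasDerivAt_star_mul` (product rule for `conj(c)·q`);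
* §3 ★★ `hasDerivAt_liftQuat` — the central lift along a curve of block data: `d/ds liftQuat σ z(s) = (−σ(z·ż)/√(1−|z|²))•1 + Σ_b ż_b•u_b` (✓`hasDerivAt_liftQuat_re` for the
  real part), with its components (`liftQuatDeriv_components`);
* §4 ★★★ `hasDerivAt_anchoredEntry` — `d/ds Im_b(conj(lift σ z(s))·q(s)) = Im_b(conj(D)·q + conj(lift σ z)·q̇)` (`D` the lift derivative), and the three component facts
  `star_liftQuatDeriv_components` putting `conj(D)` in the letters `E` of ✓`base_motion_trace` ∕ ✓`anchored_own_trace`.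

HONEST LABEL: one-variable calculus; no lattice object appears; (E1)∕(E2) of the central piece are NOT proved here; ⟨24141⟩ and ⟨22884⟩ stay OPEN; the Yang–Mills mass
gap is NOT proved by this; no summit is proved by a line.  THEOREMS ONLY (no `def`, no `sorry`).

References: [cite: CosteEtAl1985]; [cite: arXiv220412737, §2 (2.4) (p. 10)].
-/

set_option autoImplicit false

noncomputable section

open scoped Quaternion

namespace Summit.QuantumFields.YangMills.Theorems.VirialFluxGap.FrameDerivative

/-! ## §1 Components of quaternion-valued curves -/

/-- The four components of a quaternion as continuous real-linear functionals. [folklore] -/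
theorem exists_quatComponent_clm :
    ∃ (ρ₀ ρ₁ ρ₂ ρ₃ : ℍ →L[ℝ] ℝ), (∀ q, ρ₀ q = q.re) ∧ (∀ q, ρ₁ q = q.imI) ∧ (∀ q, ρ₂ q = q.imJ) ∧ (∀ q, ρ₃ q = q.imK) :=
  ⟨LinearMap.toContinuousLinearMap { toFun := fun q : ℍ => q.re, map_add' := fun a b => by simp, map_smul' := fun c a => by simp },
   LinearMap.toContinuousLinearMap { toFun := fun q : ℍ => q.imI, map_add' := fun a b => by simp, map_smul' := fun c a => by simp },
   LinearMap.toContinuousLinearMap { toFun := fun q : ℍ => q.imJ, map_add' := fun a b => by simp, map_smul' := fun c a => by simp },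
   LinearMap.toContinuousLinearMap { toFun := fun q : ℍ => q.imK, map_add' := fun a b => by simp, map_smul' := fun c a => by simp },
   fun _ => rfl, fun _ => rfl, fun _ => rfl, fun _ => rfl⟩

/-- ★ The components of a differentiable quaternion curve are differentiable, with the components of the derivative. [folklore] -/
theorem hasDerivAt_quatComponents {f : ℝ → ℍ} {f' : ℍ} {t : ℝ} (hf : HasDerivAt f f' t) :
    HasDerivAt (fun s => (f s).re) f'.re t ∧ HasDerivAt (fun s => (f s).imI) f'.imI t ∧
      HasDerivAt (fun s => (f s).imJ) f'.imJ t ∧ HasDerivAt (fun s => (f s).imK) f'.imK t := by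
  obtain ⟨ρ₀, ρ₁, ρ₂, ρ₃, h₀, h₁, h₂, h₃⟩ := exists_quatComponent_clm
  refine ⟨?_, ?_, ?_, ?_⟩
  · have h := ρ₀.hasFDerivAt.comp_hasDerivAt t hf; simp only [Function.comp_def, h₀] at h; exact h
  · have h := ρ₁.hasFDerivAt.comp_hasDerivAt t hf; simp only [Function.comp_def, h₁] at h; exact h
  · have h := ρ₂.hasFDerivAt.comp_hasDerivAt t hf; simp only [Function.comp_def, h₂] at h; exact h
  · have h := ρ₃.hasFDerivAt.comp_hasDerivAt t hf; simp only [Function.comp_def, h₃] at h; exact h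

/-- A quaternion in the basis `1, i, j, k` (the units ✓`zUnit`). [folklore] -/
theorem quat_eq_smul_zUnit_sum (q : ℍ) : q = q.re • (1 : ℍ) + q.imI • zUnit 0 + q.imJ • zUnit 1 + q.imK • zUnit 2 := by
  ext <;> simp [zUnit]

/-- The components of a combination of the units. [folklore] -/
theorem smul_zUnit_sum_components (d₀ d₁ d₂ d₃ : ℝ) :
    (d₀ • (1 : ℍ) + d₁ • zUnit 0 + d₂ • zUnit 1 + d₃ • zUnit 2).re = d₀ ∧ (d₀ • (1 : ℍ) + d₁ • zUnit 0 + d₂ • zUnit 1 + d₃ • zUnit 2).imI = d₁ ∧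
      (d₀ • (1 : ℍ) + d₁ • zUnit 0 + d₂ • zUnit 1 + d₃ • zUnit 2).imJ = d₂ ∧ (d₀ • (1 : ℍ) + d₁ • zUnit 0 + d₂ • zUnit 1 + d₃ • zUnit 2).imK = d₃ := by
  refine ⟨?_, ?_, ?_, ?_⟩ <;> simp [zUnit]

/-- ★ A quaternion curve is differentiable when its four components are, with derivative assembled from the unit basis. [folklore] -/
theorem hasDerivAt_quat_of_components {f : ℝ → ℍ} {d₀ d₁ d₂ d₃ : ℝ} {t : ℝ} (h₀ : HasDerivAt (fun s => (f s).re) d₀ t)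
    (h₁ : HasDerivAt (fun s => (f s).imI) d₁ t) (h₂ : HasDerivAt (fun s => (f s).imJ) d₂ t) (h₃ : HasDerivAt (fun s => (f s).imK) d₃ t) :
    HasDerivAt f (d₀ • (1 : ℍ) + d₁ • zUnit 0 + d₂ • zUnit 1 + d₃ • zUnit 2) t := by
  have heq : f = fun s => (f s).re • (1 : ℍ) + (f s).imI • zUnit 0 + (f s).imJ • zUnit 1 + (f s).imK • zUnit 2 := by
    funext s; exact quat_eq_smul_zUnit_sum (f s)
  rw [heq]
  exact (((h₀.smul_const _).add (h₁.smul_const _)).add (h₂.smul_const _)).add (h₃.smul_const _)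

/-! ## §2 Conjugation and the anchored product -/

/-- ★ **Conjugation is differentiable along curves**: `d/ds conj(f(s)) = conj(ḟ)` (proved through components). [folklore] -/
theorem hasDerivAt_quat_star {f : ℝ → ℍ} {f' : ℍ} {t : ℝ} (hf : HasDerivAt f f' t) : HasDerivAt (fun s => star (f s)) (star f') t := by
  obtain ⟨h₀, h₁, h₂, h₃⟩ := hasDerivAt_quatComponents hf
  have hr : HasDerivAt (fun s => (star (f s)).re) f'.re t := by
    have e : (fun s => (star (f s)).re) = fun s => (f s).re := funext fun s => by simp
    rw [e]; exact h₀
  have hn₁ : HasDerivAt (fun s => (star (f s)).imI) (-f'.imI) t := by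
    have e : (fun s => (star (f s)).imI) = fun s => -(f s).imI := funext fun s => by simp
    rw [e]; exact h₁.neg
  have hn₂ : HasDerivAt (fun s => (star (f s)).imJ) (-f'.imJ) t := by
    have e : (fun s => (star (f s)).imJ) = fun s => -(f s).imJ := funext fun s => by simp
    rw [e]; exact h₂.neg
  have hn₃ : HasDerivAt (fun s => (star (f s)).imK) (-f'.imK) t := by
    have e : (fun s => (star (f s)).imK) = fun s => -(f s).imK := funext fun s => by simp
    rw [e]; exact h₃.neg
  refine (hasDerivAt_quat_of_components hr hn₁ hn₂ hn₃).congr_deriv ?_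
  ext <;> simp [zUnit]

/-- ★ **Product rule for the anchored profile**: `d/ds (conj(c(s))·q(s)) = conj(ċ)·q + conj(c)·q̇`. [folklore] -/
theorem hasDerivAt_star_mul {c q : ℝ → ℍ} {c' q' : ℍ} {t : ℝ} (hc : HasDerivAt c c' t) (hq : HasDerivAt q q' t) :
    HasDerivAt (fun s => star (c s) * q s) (star c' * q t + star (c t) * q') t :=
  ((hasDerivAt_quat_star hc).mul hq).congr_deriv (by noncomm_ring)

/-! ## §3 The central lift along a curve of block data -/

/-- ★★ **The central lift along a curve**: if the block data `z(s)` have componentwise velocities `dz` at `t` and `|z(t)|² < 1`, then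
`d/ds liftQuat σ z(s) = (−σ(z·dz)/√(1−|z|²))•1 + dz₀•i + dz₁•j + dz₂•k`. [cite: CosteEtAl1985] -/
theorem hasDerivAt_liftQuat (σ : ℝ) {z : ℝ → Fin 3 → ℝ} {dz : Fin 3 → ℝ} {t : ℝ} (hz : ∀ b : Fin 3, HasDerivAt (fun s => z s b) (dz b) t)
    (hlt : (z t 0) ^ 2 + (z t 1) ^ 2 + (z t 2) ^ 2 < 1) :
    HasDerivAt (fun s => liftQuat σ (z s))
      ((-σ * (z t 0 * dz 0 + z t 1 * dz 1 + z t 2 * dz 2) / Real.sqrt (1 - ((z t 0) ^ 2 + (z t 1) ^ 2 + (z t 2) ^ 2))) • (1 : ℍ) +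
        dz 0 • zUnit 0 + dz 1 • zUnit 1 + dz 2 • zUnit 2) t := by
  have hre := hasDerivAt_liftQuat_re σ hz hlt
  exact hasDerivAt_quat_of_components hre (hz 0) (hz 1) (hz 2)

/-- The components of the lift derivative. [folklore] -/
theorem liftQuatDeriv_components (σ : ℝ) (z dz : Fin 3 → ℝ) :
    ((-σ * (z 0 * dz 0 + z 1 * dz 1 + z 2 * dz 2) / Real.sqrt (1 - ((z 0) ^ 2 + (z 1) ^ 2 + (z 2) ^ 2))) • (1 : ℍ) +
        dz 0 • zUnit 0 + dz 1 • zUnit 1 + dz 2 • zUnit 2).re = -σ * (z 0 * dz 0 + z 1 * dz 1 + z 2 * dz 2) / Real.sqrt (1 - ((z 0) ^ 2 + (z 1) ^ 2 + (z 2) ^ 2)) ∧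
    ((-σ * (z 0 * dz 0 + z 1 * dz 1 + z 2 * dz 2) / Real.sqrt (1 - ((z 0) ^ 2 + (z 1) ^ 2 + (z 2) ^ 2))) • (1 : ℍ) +
        dz 0 • zUnit 0 + dz 1 • zUnit 1 + dz 2 • zUnit 2).imI = dz 0 ∧
    ((-σ * (z 0 * dz 0 + z 1 * dz 1 + z 2 * dz 2) / Real.sqrt (1 - ((z 0) ^ 2 + (z 1) ^ 2 + (z 2) ^ 2))) • (1 : ℍ) +
        dz 0 • zUnit 0 + dz 1 • zUnit 1 + dz 2 • zUnit 2).imJ = dz 1 ∧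
    ((-σ * (z 0 * dz 0 + z 1 * dz 1 + z 2 * dz 2) / Real.sqrt (1 - ((z 0) ^ 2 + (z 1) ^ 2 + (z 2) ^ 2))) • (1 : ℍ) +
        dz 0 • zUnit 0 + dz 1 • zUnit 1 + dz 2 • zUnit 2).imK = dz 2 :=
  smul_zUnit_sum_components _ _ _ _

/-! ## §4 The anchored entry along a curve -/

/-- ★★★ **The anchored entry along a curve**: with `c(s) = liftQuat σ z(s)` (block data velocities `dz`, `|z|² < 1`) and a variable quaternion `q(s)` with velocity
`q'`, each imaginary component of `conj(c(s))·q(s)` is differentiable with derivative the component of `conj(D)·q + conj(c)·q'`, `D` the lift derivative of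
✓`hasDerivAt_liftQuat`. [cite: CosteEtAl1985] -/
theorem hasDerivAt_anchoredEntry (σ : ℝ) {z : ℝ → Fin 3 → ℝ} {dz : Fin 3 → ℝ} {q : ℝ → ℍ} {q' : ℍ} {t : ℝ}
    (hz : ∀ b : Fin 3, HasDerivAt (fun s => z s b) (dz b) t) (hlt : (z t 0) ^ 2 + (z t 1) ^ 2 + (z t 2) ^ 2 < 1) (hq : HasDerivAt q q' t) :
    HasDerivAt (fun s => (star (liftQuat σ (z s)) * q s).imI) (star ((-σ * (z t 0 * dz 0 + z t 1 * dz 1 + z t 2 * dz 2) / Real.sqrt (1 - ((z t 0) ^ 2 + (z t 1) ^ 2 + (z t 2) ^ 2))) • (1 : ℍ) + dz 0 • zUnit 0 + dz 1 • zUnit 1 + dz 2 • zUnit 2) * q t + star (liftQuat σ (z t)) * q').imI t ∧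
    HasDerivAt (fun s => (star (liftQuat σ (z s)) * q s).imJ) (star ((-σ * (z t 0 * dz 0 + z t 1 * dz 1 + z t 2 * dz 2) / Real.sqrt (1 - ((z t 0) ^ 2 + (z t 1) ^ 2 + (z t 2) ^ 2))) • (1 : ℍ) + dz 0 • zUnit 0 + dz 1 • zUnit 1 + dz 2 • zUnit 2) * q t + star (liftQuat σ (z t)) * q').imJ t ∧
    HasDerivAt (fun s => (star (liftQuat σ (z s)) * q s).imK) (star ((-σ * (z t 0 * dz 0 + z t 1 * dz 1 + z t 2 * dz 2) / Real.sqrt (1 - ((z t 0) ^ 2 + (z t 1) ^ 2 + (z t 2) ^ 2))) • (1 : ℍ) + dz 0 • zUnit 0 + dz 1 • zUnit 1 + dz 2 • zUnit 2) * q t + star (liftQuat σ (z t)) * q').imK t := by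
  have h := hasDerivAt_star_mul (hasDerivAt_liftQuat σ hz hlt) hq
  obtain ⟨-, h₁, h₂, h₃⟩ := hasDerivAt_quatComponents h
  exact ⟨h₁, h₂, h₃⟩

/-- ★ **The conjugate lift derivative in the letters of ✓`base_motion_trace`**: `E = conj(D)` has `E.re = −σ·ri·(z·dz)` (`ri = (√(1−|z|²))⁻¹`) and
`E.im = −dz`. [folklore] -/
theorem star_liftQuatDeriv_components (σ : ℝ) (z dz : Fin 3 → ℝ) :
    (star ((-σ * (z 0 * dz 0 + z 1 * dz 1 + z 2 * dz 2) / Real.sqrt (1 - ((z 0) ^ 2 + (z 1) ^ 2 + (z 2) ^ 2))) • (1 : ℍ) + dz 0 • zUnit 0 + dz 1 • zUnit 1 + dz 2 • zUnit 2)).re = -σ * (Real.sqrt (1 - ((z 0) ^ 2 + (z 1) ^ 2 + (z 2) ^ 2)))⁻¹ * (z 0 * dz 0 + z 1 * dz 1 + z 2 * dz 2) ∧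
    (star ((-σ * (z 0 * dz 0 + z 1 * dz 1 + z 2 * dz 2) / Real.sqrt (1 - ((z 0) ^ 2 + (z 1) ^ 2 + (z 2) ^ 2))) • (1 : ℍ) + dz 0 • zUnit 0 + dz 1 • zUnit 1 + dz 2 • zUnit 2)).imI = -dz 0 ∧ (star ((-σ * (z 0 * dz 0 + z 1 * dz 1 + z 2 * dz 2) / Real.sqrt (1 - ((z 0) ^ 2 + (z 1) ^ 2 + (z 2) ^ 2))) • (1 : ℍ) + dz 0 • zUnit 0 + dz 1 • zUnit 1 + dz 2 • zUnit 2)).imJ = -dz 1 ∧ (star ((-σ * (z 0 * dz 0 + z 1 * dz 1 + z 2 * dz 2) / Real.sqrt (1 - ((z 0) ^ 2 + (z 1) ^ 2 + (z 2) ^ 2))) • (1 : ℍ) + dz 0 • zUnit 0 + dz 1 • zUnit 1 + dz 2 • zUnit 2)).imK = -dz 2 := by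
  obtain ⟨hr, hi, hj, hk⟩ := liftQuatDeriv_components σ z dz
  refine ⟨?_, ?_, ?_, ?_⟩
  · rw [Quaternion.re_star, hr]; ring
  · rw [Quaternion.imI_star, hi]
  · rw [Quaternion.imJ_star, hj]
  · rw [Quaternion.imK_star, hk]

end Summit.QuantumFields.YangMills.Theorems.VirialFluxGap.FrameDerivative

end
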